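import Mathlib
import Summits.Langlands.Langlands.Theses.PicardMuOrdinary
import Literature.NumberTheory.GaloisRepresentations.GaloisRep
import Literature.NumberTheory.GaloisRepresentations.AbsGaloisOuterConj
import Literature.NumberTheory.GaloisRepresentations.OrdinaryRegular
import Literature.NumberTheory.GaloisRepresentations.NearlyOrdinaryDeformationRing
import Literature.NumberTheory.GaloisRepresentations.SuperellipticTorsionRep
import Literature.NumberTheory.GaloisRepresentations.CubicResidueSymbol
import Literature.NumberTheory.Automorphic.ReciprocityGLn

/-!
# Route `PicardMuOrdinary`, crux `MuOrdinaryFamilyRT` (stmt-Langlands-13757): vocabulary of the line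
# `free-seed-smooth-rt`

Route-posited objects (D-0016 `<Route>Defs`-type file) shared by the registered stubs of the checked
skeleton `Cruxes/MuOrdinaryFamilyRT/Lines/free-seed-smooth-rt.lean` (lead copy `work/MuOrdinaryFamilyRT.lean`,
registered 2026-08-16 by `ledger skeleton check`: stubs `stub_point`, `stub_host`, `stub_squeeze`,
`stub_accumulate`, `stub_endgame`, `stub_outOfScope`) and by the crux file that composes them.  NOTHING IS
ASSERTED here: every `def … : Prop` below is a *statement* consumed only as (part of) the type of a stub theorem
or of the crux.  Declared in the skeleton's namespace
`Summit.Langlands.Langlands.Cruxes.MuOrdinaryFamilyRT.FreeSeedSmoothRt`, so that a landed stub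
`theorem stub_<name> : <registered signature>` reads byte-identically to its registration (`S.stub_<name>`).

Contents (VERBATIM from the planner's checked skeleton, planner-cruxplan-stmt-Langlands-13757-free-seed-smooth-rt-0,
2026-08-16; statements unchanged, only the module docstring is new):

* §0 `K = ℚ(ω)`, `Generic f`, the crux's `ResidualHyp` / `LimitConclusion` VERBATIM, `crux_iff` (`Iff.rfl`);
* §1 `badPrimes f` (primes of `K` dividing `3 · disc f · lc f`), `picardC` (`ι⁻¹ e(a_𝔭(f))` in `ℚ̄₃`), `Roots`, the
  framed heart `rbar`, `IsUpper3`, `IsDistinguishedFlag`; §2 the type-`Δ` problem `IsTypeDelta` and the INTERFACE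
  `UniversalRing`; §3 `PointData`, `TangentLE3`, `SeedExists`; §4 `HostData`; §5 scope `PicardBorelAt3`,
  `ResiduallyDistinguished`, `InScope`;
* §6 the statements `S.stub_point`, `S.stub_host`, `S.stub_endgame`, `S.stub_outOfScope` of four of the six
  registered stubs; the two Mathlib-only statements `S.stub_squeeze` / `S.stub_accumulate` are declared next to
  their proofs in `PicardMuOrdinaryMuOrdinaryFamilyRTSqueeze.lean` / `…Accumulate.lean` (same namespace).

Conventions: traces of ARITHMETIC Frobenii (`IsArithFrobAt`); `tr ρ_C(Frob_𝔭) = ι⁻¹ e(a_𝔭(f))`; classical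
points have `ι tr ρ_y(Frob_𝔭) = N𝔭 · Σ Satake`.  Design notes: line card `Cruxes/MuOrdinaryFamilyRT/Lines/free-seed-smooth-rt.md`.
-/

-- `Summit.Langlands.Langlands.…` (summit = sub-problem name, D-0017 layout) trips `dupNamespace` on every decl.
set_option linter.dupNamespace false
set_option autoImplicit false

namespace Summit.Langlands.Langlands.Cruxes.MuOrdinaryFamilyRT.FreeSeedSmoothRt

open scoped NumberField Polynomial Matrix Classical
open Field IsDedekindDomain Polynomial
open Literature.NumberTheory.GaloisRepresentations Literature.NumberTheory.Automorphic

noncomputable section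

/-! ## 0. The base field and the crux, cut into hypothesis and conclusion -/

/-- `K = ℚ(ω)`. -/
abbrev K : Type := CyclotomicField 3 ℚ

/-- `ℚ(ω)/ℚ` is Galois (cyclotomic); instance search does not find it through `CyclotomicField`. -/
instance instIsGaloisK : IsGalois ℚ K := by
  haveI : IsCyclotomicExtension {3} ℚ K := CyclotomicField.isCyclotomicExtension 3 ℚ
  exact IsCyclotomicExtension.isGalois {3} ℚ K

/-- The crux's standing hypotheses on `f`: a separable integer quartic with `Gal ∈ {A₄, S₄}`. -/
def Generic (f : ℤ[X]) : Prop :=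
  f.natDegree = 4 ∧ (f.map (Int.castRingHom ℚ)).Separable ∧ 12 ∣ Nat.card (f.map (Int.castRingHom ℚ)).Gal

/-- The crux's residual-automorphy hypothesis, VERBATIM (unused by the line except in
`stub_outOfScope`: the free seed replaces it, cf. TRIAGE-r1-1 cross-cutting note 2). -/
def ResidualHyp (f : ℤ[X]) (hcpt : isCompact_glFiniteIntegralLevel 3 (CyclotomicField 3 ℚ)) : Prop :=
  ∃ (P : Literature.NumberTheory.Automorphic.CuspidalAutomorphicRepData 3 (CyclotomicField 3 ℚ) hcpt) (𝔐 : Ideal (integralClosure ℤ ℂ)), P.1.IsRegularAlgebraic ∧ 𝔐.IsMaximal ∧ (3 : (integralClosure ℤ ℂ)) ∈ 𝔐 ∧ ∀ᶠ 𝔭 : IsDedekindDomain.HeightOneSpectrum (NumberField.RingOfIntegers (CyclotomicField 3 ℚ)) in Filter.cofinite, ∃ (α : Multiset ℂ) (Q : Polynomial (integralClosure ℤ ℂ)), P.1.HasSatakeParamAt 𝔭 α ∧ Q.map (algebraMap (integralClosure ℤ ℂ) ℂ) = (α.map (fun a => Polynomial.X - Polynomial.C ((𝔭.residueCard : ℂ)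 * a))).prod ∧ Q.map (Ideal.Quotient.mk 𝔐) = (if (f.map ((Ideal.Quotient.mk 𝔭.asIdeal).comp (algebraMap ℤ (NumberField.RingOfIntegers (CyclotomicField 3 ℚ))))).roots.toFinset.card = 4 then (Polynomial.X - 1) ^ 3 else if (f.map ((Ideal.Quotient.mk 𝔭.asIdeal).comp (algebraMap ℤ (NumberField.RingOfIntegers (CyclotomicField 3 ℚ))))).roots.toFinset.card = 2 then (Polynomial.X - 1) ^ 2 * (Polynomial.X + 1) else if (f.map ((Ideal.Quotient.mk 𝔭.asIdeal).comp (algebraMap ℤ (NumberField.RingOfIntegers (CyclotomicField 3 ℚ))))).roots.toFinset.card = 1 then Polynomial.X ^ 3 - 1 else if (∃ y : ((NumberField.RingOfIntegers (CyclotomicField 3 ℚ)) ⧸ 𝔭.asIdeal), y ^ 2 = (f.map ((Ideal.Quotient.mk 𝔭.asIdeal).comp (algebraMap ℤ (NumberField.RingOfIntegers (CyclotomicField 3 ℚ))))).discr) then (Polynomial.X - 1) * (Polynomial.X + 1) ^ 2 else Polynomial.X ^ 3 + Polynomial.X ^ 2 + Polynomial.X + 1 : Polynomial ℤ).map (Int.castRingHom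 ((integralClosure ℤ ℂ) ⧸ 𝔐))

/-- The crux's conclusion, VERBATIM: `ρ_C` is a 3-adic limit of regular algebraic cuspidal `P_k`. -/
def LimitConclusion (f : ℤ[X]) (hcpt : isCompact_glFiniteIntegralLevel 3 (CyclotomicField 3 ℚ)) : Prop :=
  ∃ (e : CyclotomicField 3 ℚ →+* ℂ) (𝔐 : Ideal (integralClosure ℤ ℂ)) (S : Finset (IsDedekindDomain.HeightOneSpectrum (NumberField.RingOfIntegers (CyclotomicField 3 ℚ)))), 𝔐.IsMaximal ∧ (3 : (integralClosure ℤ ℂ)) ∈ 𝔐 ∧ ∀ k : ℕ, ∃ P : Literature.NumberTheory.Automorphic.CuspidalAutomorphicRepData 3 (CyclotomicField 3 ℚ) hcpt, P.1.IsRegularAlgebraic ∧ ∀ 𝔭 ∉ S, ∃ (α : Multiset ℂ) (t u : (integralClosure ℤ ℂ)), P.1.HasSatakeParamAt 𝔭 α ∧ (t : ℂ) = (𝔭.residueCard : ℂ) * α.sum - e (Literature.NumberTheory.GaloisRepresentations.picardTrace f 𝔭) ∧ u ∉ 𝔐 ∧ u * t ∈ Ideal.span {(3 : (integralClosure ℤ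 ℂ)) ^ k}

/-- The crux is literally `∀ f hcpt, Generic-hypotheses → ResidualHyp → LimitConclusion`. -/
theorem crux_iff :
    Summit.Langlands.Langlands.Theses.PicardMuOrdinary.MuOrdinaryFamilyRT ↔
      ∀ (f : ℤ[X]) (hcpt : isCompact_glFiniteIntegralLevel 3 (CyclotomicField 3 ℚ)),
        f.natDegree = 4 → (f.map (Int.castRingHom ℚ)).Separable →
          12 ∣ Nat.card (f.map (Int.castRingHom ℚ)).Gal → ResidualHyp f hcpt → LimitConclusion f hcpt :=
  Iff.rfl

/-! ## 1. Arithmetic data of `f` -/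

/-- The finite set of bad places `S(f)`: primes of `K` dividing `3 · disc f · lc f` (contains `λ`,
the bad reduction of `C_f : y³ = f(x)`, the ramification of the heart representation, of the seed
and of all twisting characters used in the line). -/
def badPrimes (f : ℤ[X]) : Set (HeightOneSpectrum (𝓞 K)) :=
  {v | ((3 * f.discr * f.leadingCoeff : ℤ) : 𝓞 K) ∈ v.asIdeal}

/-- The Picard trace transported to `ℚ̄₃`: `c_𝔭 = ι⁻¹(e(a_𝔭(f)))`. -/
def picardC (f : ℤ[X]) (ι : PadicAlgCl 3 ≃+* ℂ) (e : K →+* ℂ) (𝔭 : HeightOneSpectrum (𝓞 K)) :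
    PadicAlgCl 3 :=
  ι.symm (e ((picardTrace f 𝔭 : 𝓞 K) : K))

/-- The roots of `f` in `K̄` (a finite `Γ_K`-set with 4 elements for generic `f`). -/
abbrev Roots (f : ℤ[X]) : Type := ((f.map (algebraMap ℤ K)).rootSet (AlgebraicClosure K))

/-- **The framed heart (branch-point) representation** `r̄_f^B : Γ_K → GL₃(𝔽₃)`: the tree's
`heartRep 3` of `Γ_K` on `𝔽₃^{roots}/𝔽₃·1 = (𝔽₃⁴)⁰` (`≅ J(C_f)[1-ω]`, Poonen–Schaefer, proved in the
tree as `superelliptic_lambdaTorsion_iso_heart_holds`) written in the basis `B`. -/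
def rbar (f : ℤ[X]) (B : Module.Basis (Fin 3) (ZMod 3) (Heart 3 (Roots f))) :
    absoluteGaloisGroup K →* GL (Fin 3) (ZMod 3) :=
  (Units.map ((LinearMap.toMatrixAlgEquiv B).toRingEquiv.toMonoidHom)).comp
    (heartRep 3 (Roots f) (absoluteGaloisGroup K)).asGroupHom

/-- A `3 × 3` matrix is upper triangular. -/
def IsUpper3 {R : Type*} [CommRing R] (M : Matrix (Fin 3) (Fin 3) R) : Prop :=
  M 1 0 = 0 ∧ M 2 0 = 0 ∧ M 2 1 = 0

/-- `F ∈ GL₃(𝔽₃)` is a **distinguished `Γ_{K_v}`-stable flag** of `r̄_f^B` at the place `v`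
(intended: `v = λ ∣ 3`): `F⁻¹ r̄|_{Γ_{K_v}} F` is upper triangular with pairwise distinct diagonal
characters (`GL₃`-analogue of the tree's `NearlyOrdinaryDatum.IsDistinguishedAt`). -/
def IsDistinguishedFlag (f : ℤ[X]) (B : Module.Basis (Fin 3) (ZMod 3) (Heart 3 (Roots f)))
    (v : HeightOneSpectrum (𝓞 K)) (F : GL (Fin 3) (ZMod 3)) : Prop :=
  (∀ τ, IsUpper3 (F⁻¹ * rbar f B (absGaloisRestrict K (v.adicCompletion K) τ) * F).val) ∧
    ∀ i j : Fin 3, i ≠ j →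
      (fun τ => (F⁻¹ * rbar f B (absGaloisRestrict K (v.adicCompletion K) τ) * F).val i i) ≠
        (fun τ => (F⁻¹ * rbar f B (absGaloisRestrict K (v.adicCompletion K) τ) * F).val j j)

/-! ## 2. The deformation problem `Δ` and its universal ring (interface, after the tree's
`NearlyOrdinaryDeformationRing`) -/

/-- **`ρ : Γ_K → GL₃(A)` is a deformation of type `Δ = Δ(f, B, F, m)`** to the local `𝒪`-algebra
`A` with augmentation `πA : A → 𝔽₃`: continuous (`𝔪_A`-adically), a lift of `r̄_f^B`, unramified
outside `S(f)`, **Λ-ordinary at `λ`** (Borel in a frame lifting the residual flag `F`; no condition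
on the diagonal characters: free weight) and **polarized**: `tr ρ(θ_c σ) = ε(σ)^m · tr ρ(σ⁻¹)` for
every complex conjugation `c ∈ Γ_ℚ` (`θ_c = absGaloisOuterConj ℚ K c`, `ε` the 3-adic cyclotomic
character).  For `ρ_C` (dual of `H¹_ω`): `m = 1`. -/
def IsTypeDelta (f : ℤ[X]) (B : Module.Basis (Fin 3) (ZMod 3) (Heart 3 (Roots f))) (F : GL (Fin 3) (ZMod 3))
    (m : ℤ) (𝒪 : Type) [CommRing 𝒪] [Algebra ℤ_[3] 𝒪]
    {A : Type} [CommRing A] [IsLocalRing A] [Algebra 𝒪 A] (πA : A →+* ZMod 3)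
    (ρ : absoluteGaloisGroup K →* GL (Fin 3) A) : Prop :=
  Deformation.IsAdicContinuous ρ ∧
  (∀ σ, (ρ σ).val.map πA = (rbar f B σ).val) ∧
  (∀ v ∉ badPrimes f, Deformation.IsUnramifiedAt v ρ) ∧
  (∀ v : HeightOneSpectrum (𝓞 K), (3 : 𝓞 K) ∈ v.asIdeal →
    ∃ g : GL (Fin 3) A, IsUpper3 (F⁻¹ * Matrix.GeneralLinearGroup.map πA g).val ∧
      ∀ τ, IsUpper3 (g⁻¹ * ρ (absGaloisRestrict K (v.adicCompletion K) τ) * g).val) ∧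
  (∀ c : absoluteGaloisGroup ℚ, IsComplexConjugation (algebraMap ℚ ℝ) c →
    ∀ σ, (ρ (absGaloisOuterConj ℚ K c σ)).val.trace =
      algebraMap 𝒪 A (algebraMap ℤ_[3] 𝒪 (((GaloisRep.cyclotomicCharacter K 3 σ) ^ m : ℤ_[3]ˣ) : ℤ_[3])) *
        (ρ σ⁻¹).val.trace)

/-- **A universal deformation ring of type `Δ(f, B, F, m)` over `𝒪`** — INTERFACE, verbatim the
shape of the tree's `NearlyOrdinaryDeformationRing` for this `GL₃` problem: a complete Noetherian
local `𝒪`-algebra `R` with augmentation onto `𝔽₃`, a universal type-`Δ` lift `ρ`, and universality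
among type-`Δ` lifts to complete Noetherian local `𝒪`-algebras with residue field `𝔽₃`, up to strict
equivalence.  Existence (for `r̄_f` absolutely irreducible and `F` distinguished) is part of
`stub_point`. -/
structure UniversalRing (f : ℤ[X]) (B : Module.Basis (Fin 3) (ZMod 3) (Heart 3 (Roots f)))
    (F : GL (Fin 3) (ZMod 3)) (m : ℤ) (𝒪 : Type) [CommRing 𝒪] [Algebra ℤ_[3] 𝒪] [Algebra 𝒪 (ZMod 3)] :
    Type 1 where
  R : Type
  [instCommRing : CommRing R]
  [instIsLocalRing : IsLocalRing R]
  [instIsNoetherianRing : IsNoetherianRing R]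
  [instAlgebra : Algebra 𝒪 R]
  [instIsAdicComplete : IsAdicComplete (IsLocalRing.maximalIdeal R) R]
  π : R →ₐ[𝒪] ZMod 3
  π_surjective : Function.Surjective π
  ρ : absoluteGaloisGroup K →* GL (Fin 3) R
  isTypeDelta : IsTypeDelta f B F m 𝒪 (π : R →+* ZMod 3) ρ
  universal : ∀ (A : Type) [CommRing A] [IsLocalRing A] [IsNoetherianRing A] [Algebra 𝒪 A]
    [IsAdicComplete (IsLocalRing.maximalIdeal A) A] (πA : A →ₐ[𝒪] ZMod 3),
    Function.Surjective πA → ∀ ρA : absoluteGaloisGroup K →* GL (Fin 3) A,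
    IsTypeDelta f B F m 𝒪 (πA : A →+* ZMod 3) ρA →
    ∃! φ : R →ₐ[𝒪] A,
      Deformation.IsStrictEquiv (πA : A →+* ZMod 3) ((Matrix.GeneralLinearGroup.map (φ : R →+* A)).comp ρ) ρA

attribute [instance] UniversalRing.instCommRing UniversalRing.instIsLocalRing
  UniversalRing.instIsNoetherianRing UniversalRing.instAlgebra UniversalRing.instIsAdicComplete

/-! ## 3. The Picard point as an `𝒪`-point of `Spec R_Δ` -/

/-- **Picard point data** for `(f, ι, e)`: a basis `B` of the heart, a distinguished residual flag `F`
at `λ`, a polarization exponent `m`, a coefficient ring `𝒪` (the ring of integers of a finite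
extension of `ℚ₃` with residue field `𝔽₃`, embedded in `ℚ̄₃` by `j` compatibly with `ℤ₃`), a universal
type-`Δ` ring `𝓡`, and an `𝒪`-point `x : 𝓡.R → 𝒪` whose Frobenius traces are the Picard traces:
`j(x(tr ρ^u(Frob_𝔭))) = ι⁻¹ e(a_𝔭(f))` for `𝔭 ∉ S(f)`. (This is "ρ_C is a type-Δ deformation of
`r̄_f`": Tate module of the Picard Jacobian, `J[1-ω] ≅` heart, `K_λ`-Borel-ordinarity, Weil-pairing
polarization.) -/
structure PointData (f : ℤ[X]) (ι : PadicAlgCl 3 ≃+* ℂ) (e : K →+* ℂ) : Type 1 where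
  B : Module.Basis (Fin 3) (ZMod 3) (Heart 3 (Roots f))
  F : GL (Fin 3) (ZMod 3)
  m : ℤ
  𝒪 : Type
  [instCommRing : CommRing 𝒪]
  [instIsDomain : IsDomain 𝒪]
  [instDVR : IsDiscreteValuationRing 𝒪]
  [instAlgebra : Algebra ℤ_[3] 𝒪]
  [instFinite : Module.Finite ℤ_[3] 𝒪]
  [instAlgebraRes : Algebra 𝒪 (ZMod 3)]
  [instIsAdicComplete : IsAdicComplete (IsLocalRing.maximalIdeal 𝒪) 𝒪]
  residue_surjective : Function.Surjective (algebraMap 𝒪 (ZMod 3))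
  j : 𝒪 →+* PadicAlgCl 3
  j_injective : Function.Injective j
  j_comp : j.comp (algebraMap ℤ_[3] 𝒪) = algebraMap ℤ_[3] (PadicAlgCl 3)
  distinguished : ∀ v : HeightOneSpectrum (𝓞 K), (3 : 𝓞 K) ∈ v.asIdeal → IsDistinguishedFlag f B v F
  𝓡 : UniversalRing f B F m 𝒪
  x : 𝓡.R →ₐ[𝒪] 𝒪
  x_trace : ∀ 𝔭 ∉ badPrimes f, ∀ 𝔓 ∈ 𝔭.primesAbove, ∀ σ : absoluteGaloisGroup K,
    IsArithFrobAt (𝓞 K) σ 𝔓 → j (x (𝓡.ρ σ).val.trace) = picardC f ι e 𝔭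

attribute [instance] PointData.instCommRing PointData.instIsDomain PointData.instDVR
  PointData.instAlgebra PointData.instFinite PointData.instAlgebraRes PointData.instIsAdicComplete

/-- **Tangent condition (the card's K1, as a SCOPE condition):** the universal type-`Δ` ring is a
quotient of `𝒪⟦X,Y,Z⟧`, i.e. `dim_k 𝔪_R/(𝔪_R², ϖ) ≤ 3`, i.e. `h¹_Δ(f) ≤ 3` (equivalently, by
Greenberg–Wiles and the forced `μ₃`-class, `h¹_{Δ⊥}(ad r̄(1)) = 1`; TRIAGE-r1-1).  Per-`f`, checkable
by the card's PARI falsifier; NOT claimed for all `f`. -/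
def TangentLE3 {f : ℤ[X]} {ι : PadicAlgCl 3 ≃+* ℂ} {e : K →+* ℂ} (d : PointData f ι e) : Prop :=
  ∃ s : MvPowerSeries (Fin 3) d.𝒪 →ₐ[d.𝒪] d.𝓡.R, Function.Surjective s

/-- **The free seed, as a point of `Spec R_Δ` (SCOPE condition; the card's K2a + triage sharpening
"same maximal ideal INCLUDING the `U_λ`-refinement"):** there is a `ℚ̄₃`-point `y₀` of `d.𝓡.R` over `j`
which is (i) ORDINARY FOR THE REFINEMENT `F` with regular parallel weights up to a twist: for a
continuous character `ψ` of `Γ_K`, unramified outside `S(f)` and with `ψ ψ^c = ε^w` for some `w ∈ ℤ`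
(so `ψ` is the 3-adic avatar of an algebraic Hecke character), the diagonal characters of
`ρ^u|_{Γ_{K_λ}}` in an `F`-adapted Borel frame, pushed along `y₀`, equal `ψ · ε^{b_i}` on an open
subgroup of inertia with `b₀ > b₁ > b₂`; and (ii) AUTOMORPHIC: `ι(y₀(tr ρ^u(Frob_𝔭)) ψ(Frob_𝔭)⁻¹)
= N𝔭 · Σ Satake(P₀, 𝔭)` off `S(f)` for a regular algebraic cuspidal `P₀` on `GL₃(𝔸_K)`.  Intended
witnesses: `BC_{K/ℚ}(Sym² g) ⊗ tw` for the 3-ordinary weight-2 member `g` of the octahedral Hida family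
(odd `f`), `AI_{K₃(ω)/K}(εψ_t)` (even `f`, 3 split in `K₃`) — the `S₄ ≅ PGL₂(𝔽₃)` gift. -/
def SeedExists {f : ℤ[X]} {ι : PadicAlgCl 3 ≃+* ℂ} {e : K →+* ℂ}
    (hcpt : isCompact_glFiniteIntegralLevel 3 (CyclotomicField 3 ℚ)) (d : PointData f ι e) : Prop :=
  ∃ (y₀ : d.𝓡.R →+* PadicAlgCl 3) (ψ : FramedGaloisRep K (PadicAlgCl 3) 1) (w : ℤ),
    y₀.comp (algebraMap d.𝒪 d.𝓡.R) = d.j ∧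
    (∀ v ∉ badPrimes f, ψ.IsUnramifiedAt v) ∧
    (∀ c : absoluteGaloisGroup ℚ, IsComplexConjugation (algebraMap ℚ ℝ) c →
      ∀ σ, ψ.trace (absGaloisOuterConj ℚ K c σ) * ψ.trace σ =
        algebraMap ℤ_[3] (PadicAlgCl 3) (((GaloisRep.cyclotomicCharacter K 3 σ) ^ w : ℤ_[3]ˣ) : ℤ_[3])) ∧
    (∀ v : HeightOneSpectrum (𝓞 K), (3 : 𝓞 K) ∈ v.asIdeal →
      ∃ (g : GL (Fin 3) d.𝓡.R) (b : Fin 3 → ℤ) (U : OpenSubgroup (absoluteGaloisGroup (v.adicCompletion K))),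
        IsUpper3 (d.F⁻¹ * Matrix.GeneralLinearGroup.map (d.𝓡.π : d.𝓡.R →+* ZMod 3) g).val ∧
        (∀ τ, IsUpper3 (g⁻¹ * d.𝓡.ρ (absGaloisRestrict K (v.adicCompletion K) τ) * g).val) ∧
        StrictAnti b ∧
        ∀ (i : Fin 3), ∀ τ ∈ absInertia (v.adicCompletion K), τ ∈ U →
          y₀ ((g⁻¹ * d.𝓡.ρ (absGaloisRestrict K (v.adicCompletion K) τ) * g).val i i) =
            ψ.trace (absGaloisRestrict K (v.adicCompletion K) τ) *
              algebraMap ℤ_[3] (PadicAlgCl 3)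
                (((GaloisRep.cyclotomicCharacter (v.adicCompletion K) 3 τ) ^ (b i) : ℤ_[3]ˣ) : ℤ_[3])) ∧
    ∃ P₀ : CuspidalAutomorphicRepData 3 (CyclotomicField 3 ℚ) hcpt, P₀.1.IsRegularAlgebraic ∧
      ∀ 𝔭 ∉ badPrimes f, ∃ α : Multiset ℂ, P₀.1.HasSatakeParamAt 𝔭 α ∧
        ∀ 𝔓 ∈ 𝔭.primesAbove, ∀ σ : absoluteGaloisGroup K, IsArithFrobAt (𝓞 K) σ 𝔓 →
          ι (y₀ (d.𝓡.ρ σ).val.trace * (ψ.trace σ)⁻¹) = (𝔭.residueCard : ℂ) * α.sum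

/-! ## 4. The host: the ordinary Hida–Hecke algebra of the definite `U(3)` as a quotient of `R_Δ` -/

/-- **Host data (the card's K2b, output of `stub_host`):** the localised Λ-ordinary Hida–Hecke algebra
of the definite unitary group `U(3)_{K/ℚ}` at the maximal ideal of `(r̄_f, F)`, twist-normalised so
that its Galois representation is of type `Δ`, presented as: a complete Noetherian local `𝒪`-algebra
`T`; a SURJECTION `φ : R_Δ ↠ T` (classifying map of `ρ_T`; onto because `T` is topologically generated
by the `T_𝔭`, Carayol); a FINITE INJECTIVE structure map `Λ = 𝒪⟦T₁,T₂,T₃⟧ → T` (Hida's control on a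
finite set: `T` finite torsion-free over the weight algebra, `dim T = 4`); a set `W` of ARITHMETIC
WEIGHTS (regular dominant algebraic, as `ℚ̄₃`-points of `Λ`) such that every point of `T` over `W` is
CLASSICAL — for every `k` it comes with a regular algebraic cuspidal `P` on `GL₃(𝔸_K)` (descent/base
change `U(3) ↔ GL₃/K`, Rogawski–Mok–Labesse, then an integrality-restoring twist by `|det|^{-2·3^k c}`,
whose effect `N𝔭^{2·3^k c} ≡ 1 (mod 3^{k+1})` is harmless 3-adically: the weight-1-normalised traces of the
Picard twist are NOT algebraic integers, the crux demands integers), unramified off `S(f)`, whose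
`N𝔭 · Σ Satake` are algebraic integers EQUAL to `ι` of the point's Frobenius traces times `N𝔭^{2·3^k c}`;
and the WEIGHT FIELD: if the Picard point `j ∘ x` factors
through `φ`, arithmetic weights accumulate 3-adically at its weight (its diagonal inertial characters
are locally algebraic: potentially crystalline `ρ_C`). -/
structure HostData {f : ℤ[X]} {ι : PadicAlgCl 3 ≃+* ℂ} {e : K →+* ℂ}
    (hcpt : isCompact_glFiniteIntegralLevel 3 (CyclotomicField 3 ℚ)) (d : PointData f ι e) : Type 1 where
  T : Type
  [instCommRing : CommRing T]
  [instIsLocalRing : IsLocalRing T]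
  [instIsNoetherianRing : IsNoetherianRing T]
  [instAlgebra : Algebra d.𝒪 T]
  [instIsAdicComplete : IsAdicComplete (IsLocalRing.maximalIdeal T) T]
  φ : d.𝓡.R →ₐ[d.𝒪] T
  φ_surjective : Function.Surjective φ
  Λ : MvPowerSeries (Fin 3) d.𝒪 →ₐ[d.𝒪] T
  Λ_injective : Function.Injective Λ
  Λ_finite : Λ.toRingHom.Finite
  W : Set (MvPowerSeries (Fin 3) d.𝒪 →+* PadicAlgCl 3)
  classical : ∀ y : T →+* PadicAlgCl 3, y.comp Λ.toRingHom ∈ W → ∀ k : ℕ,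
    ∃ (c : ℕ) (P : CuspidalAutomorphicRepData 3 (CyclotomicField 3 ℚ) hcpt), P.1.IsRegularAlgebraic ∧
      ∀ 𝔭 ∉ badPrimes f, ∃ (α : Multiset ℂ) (b : integralClosure ℤ ℂ), P.1.HasSatakeParamAt 𝔭 α ∧
        (b : ℂ) = (𝔭.residueCard : ℂ) * α.sum ∧
        ∀ 𝔓 ∈ 𝔭.primesAbove, ∀ σ : absoluteGaloisGroup K, IsArithFrobAt (𝓞 K) σ 𝔓 →
          ι (y (φ (d.𝓡.ρ σ).val.trace)) * (𝔭.residueCard : ℂ) ^ (2 * 3 ^ k * c) = b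
  weightAccum : ∀ x' : T →+* PadicAlgCl 3, x'.comp φ.toRingHom = d.j.comp d.x.toRingHom →
    ∀ M : ℕ, ∃ κ ∈ W, ∀ a, ‖κ a - x' (Λ a)‖ ≤ ((3 : ℝ)⁻¹) ^ M

attribute [instance] HostData.instCommRing HostData.instIsLocalRing HostData.instIsNoetherianRing
  HostData.instAlgebra HostData.instIsAdicComplete

/-! ## 5. Scope -/

/-- **The Picard Galois representation, Borel at `λ`** (SCOPE: existence of `ρ_C` = dual of `H¹_ω` of
`C_f : y³ = f(x)` as a continuous `ρ : Γ_K → GL₃(ℚ̄₃)` with the Picard Frobenius traces `ι⁻¹ e(a_𝔭(f))`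
off `S(f)` (Néron–Ogg–Shafarevich + point count), polarized `ρ^c ≅ ρ^∨ ⊗ ε^m` in trace form (Weil pairing
+ `ℤ[ω]`-action; `m = 1`) — true for every `f`, not in the tree — AND upper-triangularisable on `Γ_{K_λ}`
(`K_λ`-ordinarity: automatic for potentially good μ-ordinary = 3-rank-2 reduction, TRIAGE-r1-1; FAILS for
the λ-supersingular `y³ - y = x⁴` type and is the genuine scope restriction). -/
def PicardBorelAt3 (f : ℤ[X]) (ι : PadicAlgCl 3 ≃+* ℂ) (e : K →+* ℂ) : Prop :=
  ∃ (ρ : FramedGaloisRep K (PadicAlgCl 3) 3) (m : ℤ),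
    (∀ 𝔭 ∉ badPrimes f, ρ.IsUnramifiedAt 𝔭 ∧
      ∀ 𝔓 ∈ 𝔭.primesAbove, ∀ σ : absoluteGaloisGroup K, IsArithFrobAt (𝓞 K) σ 𝔓 →
        ρ.trace σ = picardC f ι e 𝔭) ∧
    (∀ c : absoluteGaloisGroup ℚ, IsComplexConjugation (algebraMap ℚ ℝ) c →
      ∀ σ, ρ.trace (absGaloisOuterConj ℚ K c σ) =
        algebraMap ℤ_[3] (PadicAlgCl 3) (((GaloisRep.cyclotomicCharacter K 3 σ) ^ m : ℤ_[3]ˣ) : ℤ_[3]) *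
          ρ.trace σ⁻¹) ∧
    ∀ v : HeightOneSpectrum (𝓞 K), (3 : 𝓞 K) ∈ v.asIdeal →
      ∃ g : GL (Fin 3) (PadicAlgCl 3), ((ρ.toLocal v).conj g).IsUpperTriangular

/-- **`r̄_f` is residually distinguished at `λ`**: it has a `Γ_{K_λ}`-stable flag over `𝔽₃` with pairwise
distinct diagonal characters (holds e.g. when the decomposition group contains a 3-cycle: `V|_{S₃}` is
uniserial; fails for `D_λ ∈ {A₄, S₄}` (no flag: not μ-ordinary) and needs `𝔽₉` for a 4-cycle — conceded). -/
def ResiduallyDistinguished (f : ℤ[X]) : Prop :=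
  ∃ (B : Module.Basis (Fin 3) (ZMod 3) (Heart 3 (Roots f))) (F : GL (Fin 3) (ZMod 3)),
    ∀ v : HeightOneSpectrum (𝓞 K), (3 : 𝓞 K) ∈ v.asIdeal → IsDistinguishedFlag f B v F

/-- **The scope of the line**: `ρ_C` Borel at `λ`, `r̄_f` residually distinguished, and for every Picard
point datum a free seed with the same refinement and tangent dimension `≤ 3`. -/
def InScope (f : ℤ[X]) (hcpt : isCompact_glFiniteIntegralLevel 3 (CyclotomicField 3 ℚ)) : Prop :=
  ∃ (ι : PadicAlgCl 3 ≃+* ℂ) (e : K →+* ℂ), PicardBorelAt3 f ι e ∧ ResiduallyDistinguished f ∧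
    ∀ d : PointData f ι e, SeedExists hcpt d ∧ TangentLE3 d

/-! ## 6. Statements of four of the six registered stubs (the registered stubs are `theorem stub_* : S.stub_*`) -/

/-- STUB 1 (THE PICARD POINT; deformation theory).  For generic `f`, given the polarized, `λ`-Borel Picard
representation `ρ` of `PicardBorelAt3` and residual distinguishedness: (a) `ρ` descends to `𝒪 = 𝒪_{E₀}`,
`E₀ = ℚ₃(traces) ⊆ ι⁻¹e(K_λ)` (residually absolutely irreducible: Carayol; `𝒪` is a DVR finite over `ℤ₃`
with residue field `𝔽₃`), (b) its reduction is the heart `r̄_f` in some basis `B` (trace of the heart at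
`Frob_𝔭` = `#roots(f mod 𝔭) - 1 ≡ a_𝔭(f)` by `picardTrace_sub_card_roots_sub_one_mem_span`;
Brauer–Nesbitt + Chebotarev; the heart of `A₄/S₄` on `𝔽₃⁴/diag` is absolutely irreducible with scalar
centraliser, kit j007087/j007470), (c) its Borel flag at `λ` is `E₀`-rational and reduces to a
distinguished `r̄`-stable flag `F`, (d) the type-`Δ(f,B,F,m)` problem is representable over `𝒪`
(Mazur + relative representability of "Borel lifting a distinguished flag" and of the closed trace
condition "polarized"), and `ρ` is an `𝒪`-point `x` of it with `j ∘ x ∘ tr ρ^u = ι⁻¹ e(a_𝔭)`.  Size L.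
Leans on: tree `Deformation.*`, `CNLAlgebra`, `PowerSeriesAt` (Mazur §20), `heartRep`,
`superelliptic_lambdaTorsion_iso_heart_holds` (not even needed: the heart is used abstractly),
`exists_hasQlModel`, `chebotarev_artinRep`-type facts, `brauerNesbitt`. -/
def S.stub_point : Prop :=
  ∀ (f : ℤ[X]) (ι : PadicAlgCl 3 ≃+* ℂ) (e : K →+* ℂ),
    Generic f → PicardBorelAt3 f ι e → ResiduallyDistinguished f → Nonempty (PointData f ι e)

/-- STUB 2 (THE HOST = FREE SEED ⇒ HIDA FAMILY; the card's K2, hardest).  For generic `f` and a Picard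
point datum `d` admitting a seed (`SeedExists`): the Λ-ordinary Hida theory of the DEFINITE unitary group
`U(3)_{K/ℚ}` at the ramified prime `λ` (ordinary projector for `u = diag(ϖ_λ, 1, ϖ̄_λ⁻¹)`, `Λ =
𝒪⟦(𝒪_{K_λ}^×)_{(3)} × U(1)^{(3)}⟧ ≅ 𝒪⟦T₁,T₂,T₃⟧`, vertical control at regular dominant weights —
functions on finite sets, unwritten at ramified 3 but routine), Galois representations over the
localised Hecke algebra (Chenevier determinants, fine at `p = n = 3`; Λ-ordinary at `λ` by local–global
compatibility at the dense classical points, Caraiani; polarized; unramified off `S(f)`), hence the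
classifying surjection `R_Δ ↠ T` (Carayol), classicality + descent/base change `U(3) ↔ GL₃/K`
(Rogawski, Mok, Labesse; `n = 3` odd: no sign obstruction) with integral `N𝔭·ΣSatake`, and the weight
field (the Λ-weight of a Galois point is read off its diagonal inertial characters; those of `ρ_C` are
locally algebraic, so regular dominant arithmetic weights accumulate at it).  The seed makes `T_𝔪 ≠ 0`
in the `F`-refinement; all twists by the algebraic `ψ` (`ψψ^c = ε^w`) are internal to the proof.
Size XL (the lead splits it into helpers via `--supports`).  Sources: Geraghty2018 §2, Hida2002,
BellaicheChenevier/arXiv:0805.2095 p. 2, Chenevier2011, Caraiani2014, Mok2014, HarrisLanTaylorThorneRMS2016. -/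
def S.stub_host : Prop :=
  ∀ (f : ℤ[X]) (hcpt : isCompact_glFiniteIntegralLevel 3 (CyclotomicField 3 ℚ))
    (ι : PadicAlgCl 3 ≃+* ℂ) (e : K →+* ℂ) (d : PointData f ι e),
    Generic f → SeedExists hcpt d → Nonempty (HostData hcpt d)

/-- STUB 5 (ENDGAME; the card's K3: classicality at the approximants + the `ℚ̄₃`-norm ↔ `ℤ̄_𝔐`
dictionary).  Given the host `h`, the Picard point transported to `T` (`x' ∘ φ = j ∘ x`, available after
the squeeze) and points `y` of `T` over arithmetic weights uniformly within `3^{-M}` of `x'` for every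
`M`: each such `y` is classical (`h.classical`), giving a regular algebraic cuspidal `P` unramified off
`S(f)` with `ι tr · N𝔭^{2·3^k c} = N𝔭·Σα =: b ∈ ℤ̄`, and `‖ι⁻¹ b - ι⁻¹ e(a_𝔭)‖ ≤ 3^{-(k+1)}` for `M ≥ k+1`
(`N𝔭^{2·3^k c} ≡ 1 mod 3^{k+1}`, values of `x'` have norm `≤ 1`); with `𝔐 := {z ∈ ℤ̄ : ‖ι⁻¹ z‖
< 1}` (maximal, `∋ 3`) and `t := b - e(a_𝔭) ∈ ℤ̄` this is `t ∈ 3^k ℤ̄_𝔐`, i.e. `∃ u ∉ 𝔐, u t ∈ (3^k)`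
(`ℤ̄_𝔐` is the valuation ring of the place `ι` induces on `ℚ̄`).  `S :=` the finite set `S(f)`; `e := e`.
Size M/L.  Leans on: Mathlib `integralClosure`, valuation subrings / `IsLocalization.AtPrime`,
`padicNormE`; normalisation `N𝔭·Σα` audited by the refuter (crux-attack EVIDENCE.md). -/
def S.stub_endgame : Prop :=
  ∀ (f : ℤ[X]) (hcpt : isCompact_glFiniteIntegralLevel 3 (CyclotomicField 3 ℚ))
    (ι : PadicAlgCl 3 ≃+* ℂ) (e : K →+* ℂ) (d : PointData f ι e) (h : HostData hcpt d)
    (x' : h.T →+* PadicAlgCl 3), Generic f → x'.comp h.φ.toRingHom = d.j.comp d.x.toRingHom →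
    (∀ M : ℕ, ∃ κ ∈ h.W, ∃ y : h.T →+* PadicAlgCl 3,
      y.comp h.Λ.toRingHom = κ ∧ ∀ t, ‖y t - x' t‖ ≤ ((3 : ℝ)⁻¹) ^ M) →
    LimitConclusion f hcpt

/-- STUB 6 — **NOT A LEMMA OF THIS LINE: the conceded complement.**  For generic `f` OUTSIDE the scope
(`ρ_C` not Borel at `λ` — λ-supersingular `y³ - y = x⁴` type or not potentially good —, `r̄_f` not
residually distinguished over `𝔽₃`, no free seed in the `F`-refinement, or `h¹_Δ(f) > 3`) the crux as
typed.  This is the route's foreseen `RTSupersingular`-type remainder (two-layer plan (1), refuter O1)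
plus the non-smooth members handed to the patching lines (cards weight-blind-lambda-adic-rt /
definite-trianguline-fern); it is recorded ONLY so that the composition concludes `MuOrdinaryFamilyRT` by
name for every `f`.  No prover of this line should claim it; the tenure planner should turn it into the
planned split of the crux.  Size: open problem. -/
def S.stub_outOfScope : Prop :=
  ∀ (f : ℤ[X]) (hcpt : isCompact_glFiniteIntegralLevel 3 (CyclotomicField 3 ℚ)),
    Generic f → ¬ InScope f hcpt → ResidualHyp f hcpt → LimitConclusion f hcpt

end

end Summit.Langlands.Langlands.Cruxes.MuOrdinaryFamilyRT.FreeSeedSmoothRt
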